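import Literature.Computability.QuantumComplexity.CliffordTPathSums
import HarnessLib

/-!
# Exact amplitudes of Clifford+T circuits in `ℤ[ω]`, and the four gates in the Schrödinger picture

Arithmetic layer of the brute-force (state-vector) simulation of the light cone of a measured
wire, used to discharge `Literature.Barriers.QuantumAdvantage.markovShi2008_cor15_anyOrder`
(Markov–Shi 2008, Cor. 1.5, decision form). A Clifford+`T` circuit with `h` Hadamard gates maps a
basis state to a vector with amplitudes in `2^{-h/2} ℤ[ω]`, `ω = e^{iπ/4}`; the simulator stores an
amplitude as the four integer coordinates of an element of `ℤ[ω] = ℤ⟨1, ω, ω², ω³⟩` (`ω⁴ = -1`)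
and the exponent `h` globally. This file provides

* `Amp` — integer quadruples `(c₀, c₁, c₂, c₃)` with value `Amp.eval ζ a = Σ cₖ ζᵏ`, addition,
  negation, the unit, and `Amp.mulOmega` (multiplication by `ζ`, valid for `ζ⁴ = -1`);
* `Amp.normA`, `Amp.normB` — the integers `A(a) = Σ cₖ²`, `B(a) = c₀c₁ + c₁c₂ + c₂c₃ − c₀c₃` with
  **`‖eval ω a‖² = A + √2 B`** (`normSq_eval_omega`) and, for the Galois conjugate `ω⁵ = −ω`
  (`√2 ↦ −√2`), `‖eval ω⁵ a‖² = A − √2 B` (`normSq_eval_omega5`);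
* the **pull form** of the `ζ`-semantics `semZeta` (`CliffordTPathSums.lean`) of the four gates on
  an arbitrary state vector `v`: `(H_i v)(y) = (v(y[i↦0]) ± v(y[i↦1]))/√2`,
  `(S_i v)(y) = i^{y_i} v(y)`, `(T_i v)(y) = ζ^{y_i} v(y)`, `(CNOT_{ij} v)(y) = v(y[j ↦ y_j ⊕ y_i])`
  (`semZeta_mulVec_apply_H/S/T/CNOT`), from the entry formula of a one-wire placement
  (`placeGate_wireEmb_mulVec_apply`).

## References

* M. A. Nielsen, I. L. Chuang, *Quantum Computation and Quantum Information*, CUP 2010, §4.2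
  (the gates `H`, `S`, `T`, `CNOT`), §4.5.5 / Box 4.1 (exact classical simulation by storing the
  `2ⁿ` amplitudes).
* B. Giles, P. Selinger, *Exact synthesis of multiqubit Clifford+T circuits*, Phys. Rev. A 87
  (2013) 032332, §2 (Clifford+`T` matrix entries lie in `ℤ[1/√2, i] = ℤ[ω][1/√2]`). (Standard;
  only the elementary closure of `ℤ[ω]` under the gate entries is used, proved here.)
-/

noncomputable section

namespace Literature.Computability.QuantumComplexity

open _root_.Computability Complexity Cryptography Matrix

namespace LightCone

/-! ### Elements of `ℤ[ω]` by coordinates -/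

/-- An element `c₀ + c₁ ω + c₂ ω² + c₃ ω³` of `ℤ[ω]` (`ω = e^{iπ/4}`, `ω⁴ = -1`) by its integer
coordinates: the exact amplitude ring (up to the global factor `2^{-h/2}`) of Clifford+`T`
circuits on basis states. (Giles–Selinger 2013, §2.) [folklore] -/
structure Amp where
  /-- coordinate of `1` -/
  c0 : ℤ
  /-- coordinate of `ω` -/
  c1 : ℤ
  /-- coordinate of `ω²` -/
  c2 : ℤ
  /-- coordinate of `ω³` -/
  c3 : ℤ
deriving DecidableEq, Inhabited

namespace Amp

/-- The complex value `Σ cₖ ζᵏ` of a coordinate quadruple at `ζ`. [folklore] -/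
def eval (ζ : ℂ) (a : Amp) : ℂ := a.c0 + a.c1 * ζ + a.c2 * ζ ^ 2 + a.c3 * ζ ^ 3

/-- Zero. [folklore] -/
instance : Zero Amp := ⟨⟨0, 0, 0, 0⟩⟩

/-- One. [folklore] -/
instance : One Amp := ⟨⟨1, 0, 0, 0⟩⟩

/-- Coordinatewise addition. [folklore] -/
instance : Add Amp := ⟨fun a b => ⟨a.c0 + b.c0, a.c1 + b.c1, a.c2 + b.c2, a.c3 + b.c3⟩⟩

/-- Coordinatewise negation. [folklore] -/
instance : Neg Amp := ⟨fun a => ⟨-a.c0, -a.c1, -a.c2, -a.c3⟩⟩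

/-- Zero, by coordinates. [folklore] -/
theorem zero_def : (0 : Amp) = ⟨0, 0, 0, 0⟩ := rfl

/-- One, by coordinates. [folklore] -/
theorem one_def : (1 : Amp) = ⟨1, 0, 0, 0⟩ := rfl

/-- Addition, by coordinates. [folklore] -/
theorem add_def (a b : Amp) : a + b = ⟨a.c0 + b.c0, a.c1 + b.c1, a.c2 + b.c2, a.c3 + b.c3⟩ := rfl

/-- Negation, by coordinates. [folklore] -/
theorem neg_def (a : Amp) : -a = ⟨-a.c0, -a.c1, -a.c2, -a.c3⟩ := rfl

/-- Multiplication by `ω` (using `ω⁴ = -1`): `(c₀, c₁, c₂, c₃) ↦ (-c₃, c₀, c₁, c₂)`. [folklore] -/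
def mulOmega (a : Amp) : Amp := ⟨-a.c3, a.c0, a.c1, a.c2⟩

/-- The rational part `A = Σ cₖ²` of `|Σ cₖ ωᵏ|² = A + B√2`. [folklore] -/
def normA (a : Amp) : ℤ := a.c0 ^ 2 + a.c1 ^ 2 + a.c2 ^ 2 + a.c3 ^ 2

/-- The `√2`-part `B = c₀c₁ + c₁c₂ + c₂c₃ − c₀c₃` of `|Σ cₖ ωᵏ|² = A + B√2`
(`ω + ω̄ = √2`, `ω² + ω̄² = 0`, `ω³ + ω̄³ = -√2`). [folklore] -/
def normB (a : Amp) : ℤ := a.c0 * a.c1 + a.c1 * a.c2 + a.c2 * a.c3 - a.c0 * a.c3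

variable (ζ : ℂ)

/-- Value of zero. [folklore] -/
@[simp] theorem eval_zero : eval ζ 0 = 0 := by simp [eval, zero_def]

/-- Value of one. [folklore] -/
@[simp] theorem eval_one : eval ζ 1 = 1 := by simp [eval, one_def]

/-- Value of a sum. [folklore] -/
@[simp] theorem eval_add (a b : Amp) : eval ζ (a + b) = eval ζ a + eval ζ b := by
  simp only [eval, add_def, Int.cast_add]; ring

/-- Value of a negation. [folklore] -/
@[simp] theorem eval_neg (a : Amp) : eval ζ (-a) = -eval ζ a := by
  simp only [eval, neg_def, Int.cast_neg]; ring

variable {ζ}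

/-- `mulOmega` multiplies the value by `ζ` whenever `ζ⁴ = -1`. [folklore] -/
theorem eval_mulOmega (hζ : ζ ^ 4 = -1) (a : Amp) : eval ζ (mulOmega a) = ζ * eval ζ a := by
  simp only [eval, mulOmega, Int.cast_neg]
  linear_combination (-(a.c3 : ℂ)) * hζ

/-- `normA` of zero. [folklore] -/
@[simp] theorem normA_zero : normA 0 = 0 := by simp [normA, zero_def]

/-- `normB` of zero. [folklore] -/
@[simp] theorem normB_zero : normB 0 = 0 := by simp [normB, zero_def]

/-- Real part of the value at `ω`. [folklore] -/
theorem eval_omega_re (a : Amp) : (eval omega a).re = a.c0 + Real.sqrt 2 / 2 * (a.c1 - a.c3) := by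
  have h3 : omega ^ 3 = Complex.I * omega := by rw [pow_succ, omega_pow_two]
  simp only [eval, omega_pow_two, h3, Complex.add_re, Complex.mul_re, Complex.intCast_re,
    Complex.intCast_im, omega_re, omega_im, Complex.I_re, Complex.I_im, Complex.mul_im]
  ring

/-- Imaginary part of the value at `ω`. [folklore] -/
theorem eval_omega_im (a : Amp) : (eval omega a).im = a.c2 + Real.sqrt 2 / 2 * (a.c1 + a.c3) := by
  have h3 : omega ^ 3 = Complex.I * omega := by rw [pow_succ, omega_pow_two]
  simp only [eval, omega_pow_two, h3, Complex.add_im, Complex.mul_im, Complex.intCast_re,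
    Complex.intCast_im, omega_re, omega_im, Complex.I_re, Complex.I_im, Complex.mul_re]
  ring

/-- **`|Σ cₖ ωᵏ|² = A + √2 B`.** [folklore] -/
theorem normSq_eval_omega (a : Amp) : ‖eval omega a‖ ^ 2 = normA a + Real.sqrt 2 * normB a := by
  rw [Complex.sq_norm, Complex.normSq_apply, eval_omega_re, eval_omega_im]
  have h2 : Real.sqrt 2 * Real.sqrt 2 = 2 := Real.mul_self_sqrt (by norm_num)
  simp only [normA, normB, Int.cast_add, Int.cast_sub, Int.cast_mul, Int.cast_pow]
  linear_combination (((a.c1 : ℝ) ^ 2 + (a.c3 : ℝ) ^ 2) / 2) * h2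

/-- The value at `ω⁵ = -ω` is the value at `ω` of the quadruple with `c₁, c₃` negated
(`ω⁵ = -ω` is also `omega_pow_five` of `ControlledHadamard.lean`, not imported here). [folklore] -/
theorem eval_omega5 (a : Amp) : eval (omega ^ 5) a = eval omega ⟨a.c0, -a.c1, a.c2, -a.c3⟩ := by
  have h5 : omega ^ 5 = -omega := by rw [pow_succ, omega_pow_four]; ring
  rw [h5]
  simp only [eval, Int.cast_neg]
  ring

/-- **`|Σ cₖ (ω⁵)ᵏ|² = A − √2 B`**: the Galois conjugate `√2 ↦ −√2`. [folklore] -/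
theorem normSq_eval_omega5 (a : Amp) : ‖eval (omega ^ 5) a‖ ^ 2 = normA a - Real.sqrt 2 * normB a := by
  rw [eval_omega5, normSq_eval_omega]
  simp only [normA, normB]
  push_cast
  ring

end Amp

/-! ### The four gates in the Schrödinger picture (pull form) -/

variable {N : ℕ}

/-- **Entry formula of a one-wire placement on an arbitrary vector**:
`(U_i v)(y) = U_{y_i,0} v(y[i↦0]) + U_{y_i,1} v(y[i↦1])`. (Nielsen–Chuang 2010, §4.2.) [folklore] -/
theorem placeGate_wireEmb_mulVec_apply (i : Fin N) (U : Matrix (QReg 1) (QReg 1) ℂ)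
    (v : QReg N → ℂ) (y : QReg N) :
    (placeGate (wireEmb i) U *ᵥ v) y =
      U (fun _ => y i) (fun _ => false) * v (Function.update y i false) +
        U (fun _ => y i) (fun _ => true) * v (Function.update y i true) := by
  classical
  have hne : Function.update y i false ≠ Function.update y i true := fun h => by
    have := congrFun h i; simp at this
  rw [Matrix.mulVec, dotProduct]
  rw [← Finset.sum_subset (Finset.subset_univ ({Function.update y i false, Function.update y i true} : Finset (QReg N)))]
  · rw [Finset.sum_pair hne, placeGate_apply, placeGate_apply, if_pos, if_pos]
    · have h1 : (y ∘ wireEmb i) = fun _ => y i := funext fun _ => by simp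
      have h2 : (Function.update y i false ∘ wireEmb i) = fun _ => false := funext fun _ => by simp
      have h3 : (Function.update y i true ∘ wireEmb i) = fun _ => true := funext fun _ => by simp
      rw [h1, h2, h3]
    · intro l hl
      rw [range_wireEmb, Set.mem_singleton_iff] at hl
      rw [Function.update_of_ne hl]
    · intro l hl
      rw [range_wireEmb, Set.mem_singleton_iff] at hl
      rw [Function.update_of_ne hl]
  · intro w _ hw
    rw [placeGate_apply]
    split_ifs with hagree
    · exfalso
      apply hw
      simp only [Finset.mem_insert, Finset.mem_singleton]
      have key : w = Function.update y i (w i) := by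
        refine Function.eq_update_iff.2 ⟨rfl, fun l hl => ?_⟩
        exact (hagree l (by rw [range_wireEmb, Set.mem_singleton_iff]; exact hl)).symm
      cases hwi : w i
      · left; rw [key, hwi]
      · right; rw [key, hwi]
    · exact zero_mul _

/-- A matrix acting as a permutation `π` on basis states pulls back amplitudes along `π`
when `π` is an involution: `(M v)(y) = v(π y)`. [folklore] -/
theorem mulVec_apply_of_perm {M : Matrix (QReg N) (QReg N) ℂ} {π : QReg N → QReg N}
    (hπ : Function.Involutive π) (hM : ∀ w, M *ᵥ basisState w = basisState (π w))
    (v : QReg N → ℂ) (y : QReg N) : (M *ᵥ v) y = v (π y) := by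
  classical
  have hentry : ∀ w, M y w = if w = π y then 1 else 0 := fun w => by
    have h := congrFun (hM w) y
    rw [mulVec_basisState] at h
    simp only at h
    rw [h, basisState_apply]
    by_cases h : w = π y
    · subst h; rw [hπ y]; simp
    · rw [if_neg h, if_neg]
      intro h'; exact h (by rw [h', hπ w])
  rw [Matrix.mulVec, dotProduct]
  simp only [hentry, ite_mul, one_mul, zero_mul, Finset.sum_ite_eq', Finset.mem_univ, if_true]

variable {ζ : ℂ}

/-- **`H` in the Schrödinger picture**: `(H_i v)(y) = (v(y[i↦0]) + (-1)^{y_i} v(y[i↦1]))/√2`.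
(Nielsen–Chuang 2010, §1.3.1, §4.2.) [folklore] -/
theorem semZeta_mulVec_apply_H (e : Fin (cliffordT.arity CliffordTOp.H) ↪ Fin N)
    (v : QReg N → ℂ) (y : QReg N) :
    (semZeta ζ (QGate.gate CliffordTOp.H e) *ᵥ v) y =
      invSqrt2 * (v (Function.update y (embH e 0) false) +
        (if y (embH e 0) = true then -1 else 1) * v (Function.update y (embH e 0) true)) := by
  have h : semZeta ζ (QGate.gate CliffordTOp.H e) = placeGate (wireEmb (embH e 0)) hGate := by
    simp only [semZeta]; rw [gateH_eq_hOn]; rfl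
  rw [h, placeGate_wireEmb_mulVec_apply]
  cases y (embH e 0) <;> simp [hGate, invSqrt2] <;> ring

/-- **`S` in the Schrödinger picture**: `(S_i v)(y) = i^{y_i} v(y)`. (Nielsen–Chuang 2010, §4.2.)
[folklore] -/
theorem semZeta_mulVec_apply_S (e : Fin (cliffordT.arity CliffordTOp.S) ↪ Fin N)
    (v : QReg N → ℂ) (y : QReg N) :
    (semZeta ζ (QGate.gate CliffordTOp.S e) *ᵥ v) y =
      (if y (embS e 0) = true then Complex.I else 1) * v y := by
  have h : semZeta ζ (QGate.gate CliffordTOp.S e) = placeGate (wireEmb (embS e 0)) sGate := by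
    simp only [semZeta]; rw [gateS_eq_sOn]; rfl
  rw [h, placeGate_wireEmb_mulVec_apply]
  cases hy : y (embS e 0)
  · have h1 : Function.update y (embS e 0) false = y := by rw [← hy, Function.update_eq_self]
    simp [sGate, funext_iff, h1]
  · have h1 : Function.update y (embS e 0) true = y := by rw [← hy, Function.update_eq_self]
    simp [sGate, funext_iff, h1]

/-- **`T` in the Schrödinger picture** (`ζ`-semantics): `(T_i v)(y) = ζ^{y_i} v(y)`.
(Nielsen–Chuang 2010, §4.2.) [folklore] -/
theorem semZeta_mulVec_apply_T (e : Fin (cliffordT.arity CliffordTOp.T) ↪ Fin N)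
    (v : QReg N → ℂ) (y : QReg N) :
    (semZeta ζ (QGate.gate CliffordTOp.T e) *ᵥ v) y =
      (if y (embT e 0) = true then ζ else 1) * v y := by
  have h : semZeta ζ (QGate.gate CliffordTOp.T e) = placeGate (wireEmb (embT e 0)) (phaseGate ζ) := by
    simp only [semZeta]; conv_lhs => rw [emb_one_eq_wireEmb (embT e)]
  rw [h, placeGate_wireEmb_mulVec_apply]
  cases hy : y (embT e 0)
  · have h1 : Function.update y (embT e 0) false = y := by rw [← hy, Function.update_eq_self]
    simp [phaseGate, funext_iff, h1]
  · have h1 : Function.update y (embT e 0) true = y := by rw [← hy, Function.update_eq_self]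
    simp [phaseGate, funext_iff, h1]

/-- **`CNOT` in the Schrödinger picture**: `(CNOT_{ij} v)(y) = v(y[j ↦ y_j ⊕ y_i])` (control
`i = e 0`, target `j = e 1`). (Nielsen–Chuang 2010, §1.3.2.) [folklore] -/
theorem semZeta_mulVec_apply_CNOT (e : Fin (cliffordT.arity CliffordTOp.CNOT) ↪ Fin N)
    (v : QReg N → ℂ) (y : QReg N) :
    (semZeta ζ (QGate.gate CliffordTOp.CNOT e) *ᵥ v) y =
      v (Function.update y (embC e 1) (y (embC e 1) ^^ y (embC e 0))) := by
  have hne := emb_two_ne (embC e)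
  have h : semZeta ζ (QGate.gate CliffordTOp.CNOT e) =
      (cnotOn (embC e 0) (embC e 1) hne).toMatrix 0 := by
    simp only [semZeta]; rw [gateCNOT_eq_cnotOn]
  rw [h]
  refine mulVec_apply_of_perm (π := fun w => Function.update w (embC e 1) (w (embC e 1) ^^ w (embC e 0)))
    (fun w => ?_) (fun w => cnotOn_mulVec_basisState 0 _ _ hne w) v y
  funext l
  by_cases hl : l = embC e 1
  · subst hl
    simp
  · simp [Function.update_of_ne hl]

end LightCone

end Literature.Computability.QuantumComplexity

end
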